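import Mathlib
import Summits.Ventures.PercRepro2.Graph
import Summits.Ventures.PercRepro2.TypedSwitchingPrimed

/-!
# The spectator (fibre) decomposition of the m9 sign kernel, and the connectivity state map
(blind cell PercRepro2, typer-1 g44, 2026-08-27; the typed bridge named in `proofs/P3-CPNC.md`
§9a — «typedCount F z τ (kerSign σ_G g) = Σ_w g(σ_G w)·(the fibre sum)»)

The sign kernel of `TypedSwitchingPrimed` is a product of a spectator weight and a weight-free
two-copy kernel, `kerSign σ g x y w = g (σ w) · signKer σ x y` with
`signKer σ y w = 1[sep(σ y) ∧ sep(σ w)]·(pq(σ y) − pq(σ w))·(rs(σ y) − rs(σ w))`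
(`kerSign_eq_mul_signKer`).  Regrouping the typed count by the spectator copy
(`TypedA3Inactive.typedCount_eq_sum_spec`, after `typedCount_swap13`) gives

  `typedCount F z τ (kerSign σ g) = Σ_{x = z off F} g (σ x) · pinnedCount (G_x) (z_x) (signKer σ)`

(`typedCount_kerSign_eq_sum_spec`): the pairs completing the spectator `x` to a typed triple are
the complementary pairs `(y, flipOn G_x y)` on the spectator's free set `G_x = specFree F τ x`
(the typed edges with `τ e = [x e] + 1`, SINGLE in the two colours), the other typed edges pinned
by `z_x = specPin F z τ x` (DOUBLE when `τ e = [x e] + 2`, ABSENT otherwise), `z` off `F`.  So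
the typed m9 sign count is a nonnegative combination of the weight-free m9 sign sums of the
fibres `(G_x, z_x)`, and m9 holds on `(F, z, τ)` as soon as every fibre's sign sum is `≤ 0`
(`typedCount_kerSign_nonpos_of_fibres`, with `typedCount_m9_iff_sign`).

The connectivity state map `connState ends p q r s` sends a configuration to its six bits
`(p~q, p~r, p~s, q~r, q~s, r~s)` (`pqSt_connState`, `rsSt_connState`, `sepSt_connState`); for it the
fibre sign sum is the weight-free sum `Σ_{ω = b off G} 1[Sep(ω) ∧ Sep(flipOn G ω)] ·
(1[p ~_ω q] − 1[p ~_{flipOn G ω} q]) · (1[r ~_ω s] − 1[r ~_{flipOn G ω} s])` in connection vocabulary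
(`pinnedCount_signKer_connState`), and the bridge reads `typedCount_kerSign_connState_eq`.
Own work; standard axioms.
-/

namespace Summit.Ventures.PercRepro2

namespace CovForm

namespace PairHarris

open Classical TypedA3

/-! ## The two-copy sign kernel and the spectator decomposition -/

section SignKer

variable {E : Type*} [Fintype E] [DecidableEq E] {R : Type*} [Field R]

/-- The weight-free two-copy sign kernel `1[sep(σ y) ∧ sep(σ w)]·(pq(σ y) − pq(σ w))·(rs(σ y) − rs(σ w))`
of a state map (bits as `0/1` in `R`). -/
noncomputable def signKer (σ : Config E → St6) (y w : Config E) : R :=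
  (if sepSt (σ y) = true ∧ sepSt (σ w) = true then (1 : R) else 0) *
    (((if pqSt (σ y) = true then (1 : R) else 0) - (if pqSt (σ w) = true then (1 : R) else 0)) *
      ((if rsSt (σ y) = true then (1 : R) else 0) - (if rsSt (σ w) = true then (1 : R) else 0)))

omit [Fintype E] [DecidableEq E] in
/-- The sign kernel of `TypedSwitchingPrimed` is the spectator weight times the two-copy sign
kernel of the reflected copies. -/
lemma kerSign_eq_mul_signKer (σ : Config E → St6) (g : St6 → R) (x y w : Config E) :
    kerSign σ g x y w = g (σ w) * signKer σ x y := by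
  unfold kerSign signKer; ring

omit [Fintype E] [DecidableEq E] in
/-- The two-copy sign kernel is symmetric in its two copies. -/
lemma signKer_comm (σ : Config E → St6) (y w : Config E) :
    (signKer σ y w : R) = signKer σ w y := by
  unfold signKer
  by_cases h : sepSt (σ y) = true ∧ sepSt (σ w) = true
  · have h' : sepSt (σ w) = true ∧ sepSt (σ y) = true := ⟨h.2, h.1⟩
    rw [if_pos h, if_pos h']; ring
  · have h' : ¬ (sepSt (σ w) = true ∧ sepSt (σ y) = true) := fun h' => h ⟨h'.2, h'.1⟩
    rw [if_neg h, if_neg h', zero_mul, zero_mul]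

/-- **The spectator decomposition of the typed m9 sign count.**  For types in `{1, 2}` on `F`,
`typedCount F z τ (kerSign σ g)` is the sum over the spectator copies `x` (agreeing with `z` off
`F`) of `g (σ x)` times the weight-free complementary-pair count of the two-copy sign kernel on the
spectator's fibre `(specFree F τ x, specPin F z τ x)`. -/
theorem typedCount_kerSign_eq_sum_spec (F : Finset E) (z : Config E) (τ : E → ℕ)
    (hτ : ∀ e ∈ F, τ e = 1 ∨ τ e = 2) (σ : Config E → St6) (g : St6 → R) :
    typedCount F z τ (kerSign σ g) =
      ∑ x : Config E, if (∀ e, e ∉ F → x e = z e)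
        then g (σ x) * pinnedCount (specFree F τ x) (specPin F z τ x) (signKer σ) else 0 := by
  rw [← typedCount_swap13 F z τ hτ (kerSign σ g), typedCount_eq_sum_spec F z τ hτ]
  refine Finset.sum_congr rfl fun x _ => ?_
  by_cases hx : ∀ e, e ∉ F → x e = z e
  · rw [if_pos hx, if_pos hx]
    unfold pinnedCount
    rw [Finset.mul_sum]
    refine Finset.sum_congr rfl fun y _ => ?_
    by_cases hy : ∀ e, e ∉ specFree F τ x → y e = specPin F z τ x e
    · rw [if_pos hy, if_pos hy]
      show kerSign σ g (flipOn (specFree F τ x) y) y x = _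
      rw [kerSign_eq_mul_signKer, signKer_comm]
    · rw [if_neg hy, if_neg hy, mul_zero]
  · rw [if_neg hx, if_neg hx]

end SignKer

/-! ## Transfer: m9 on `(F, z, τ)` from the fibres -/

section Transfer

variable {E : Type*} [Fintype E] [DecidableEq E] {R : Type*} [Field R] [LinearOrder R]
  [IsStrictOrderedRing R]

/-- If the spectator weight is nonnegative and every spectator fibre's weight-free sign sum is
`≤ 0`, the typed m9 sign count is `≤ 0`. -/
theorem typedCount_kerSign_nonpos_of_fibres (F : Finset E) (z : Config E) (τ : E → ℕ)
    (hτ : ∀ e ∈ F, τ e = 1 ∨ τ e = 2) (σ : Config E → St6) (g : St6 → R)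
    (hg : ∀ s, 0 ≤ g s)
    (hfib : ∀ x : Config E, (∀ e, e ∉ F → x e = z e) →
      pinnedCount (specFree F τ x) (specPin F z τ x) (signKer σ) ≤ (0 : R)) :
    typedCount F z τ (kerSign σ g) ≤ 0 := by
  rw [typedCount_kerSign_eq_sum_spec F z τ hτ σ g]
  refine Finset.sum_nonpos fun x _ => ?_
  by_cases hx : ∀ e, e ∉ F → x e = z e
  · rw [if_pos hx]
    exact mul_nonpos_of_nonneg_of_nonpos (hg _) (hfib x hx)
  · rw [if_neg hx]

/-- **m9 on `(F, z, τ)` from the fibres**: the move `c(pq|rs, SEP) ≤ c(pq|r|s, rs|p|q)` holds as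
soon as every spectator fibre's weight-free sign sum is `≤ 0`. -/
theorem typedCount_m9_of_fibres (F : Finset E) (z : Config E) (τ : E → ℕ)
    (hτ : ∀ e ∈ F, τ e = 1 ∨ τ e = 2) (σ : Config E → St6) (g : St6 → R)
    (hg : ∀ s, 0 ≤ g s)
    (hfib : ∀ x : Config E, (∀ e, e ∉ F → x e = z e) →
      pinnedCount (specFree F τ x) (specPin F z τ x) (signKer σ) ≤ (0 : R)) :
    typedCount F z τ (kerM9Src σ g) ≤ typedCount F z τ (kerM9Tgt σ g) :=
  (typedCount_m9_iff_sign F z τ σ g).2 (typedCount_kerSign_nonpos_of_fibres F z τ hτ σ g hg hfib)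

end Transfer

/-! ## The connectivity state map -/

section ConnState

variable {V : Type*} {E : Type*}

/-- The connectivity state map `σ_G`: the six bits `(p~q, p~r, p~s, q~r, q~s, r~s)` of a
configuration. -/
noncomputable def connState (ends : E → Sym2 V) (p q r s : V) (ω : Config E) : St6 :=
  (decide (Conn ends ω p q), decide (Conn ends ω p r), decide (Conn ends ω p s),
    decide (Conn ends ω q r), decide (Conn ends ω q s), decide (Conn ends ω r s))

variable {ends : E → Sym2 V} {p q r s : V}

/-- The `p~q` bit of the connectivity state. -/
lemma pqSt_connState (ω : Config E) :
    pqSt (connState ends p q r s ω) = true ↔ Conn ends ω p q := by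
  simp [pqSt, connState]

/-- The `r~s` bit of the connectivity state. -/
lemma rsSt_connState (ω : Config E) :
    rsSt (connState ends p q r s ω) = true ↔ Conn ends ω r s := by
  simp [rsSt, connState]

/-- The separation bit of the connectivity state: no cross connection. -/
lemma sepSt_connState (ω : Config E) :
    sepSt (connState ends p q r s ω) = true ↔
      ¬ Conn ends ω p r ∧ ¬ Conn ends ω p s ∧ ¬ Conn ends ω q r ∧ ¬ Conn ends ω q s := by
  simp [sepSt, connState, and_assoc]

variable {R : Type*} [Field R]

/-- The two-copy sign kernel of the connectivity state map, in connection vocabulary. -/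
lemma signKer_connState (y w : Config E) :
    (signKer (connState ends p q r s) y w : R) =
      (if (¬ Conn ends y p r ∧ ¬ Conn ends y p s ∧ ¬ Conn ends y q r ∧ ¬ Conn ends y q s) ∧
          (¬ Conn ends w p r ∧ ¬ Conn ends w p s ∧ ¬ Conn ends w q r ∧ ¬ Conn ends w q s)
        then (1 : R) else 0) *
      (((if Conn ends y p q then (1 : R) else 0) - (if Conn ends w p q then (1 : R) else 0)) *
        ((if Conn ends y r s then (1 : R) else 0) - (if Conn ends w r s then (1 : R) else 0))) := by
  unfold signKer
  simp only [pqSt_connState, rsSt_connState, sepSt_connState]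

variable [Fintype E] [DecidableEq E]

/-- The weight-free m9 sign sum of the fibre `(G, b)` for the connectivity state map: the sum over
the configurations `ω` agreeing with `b` off `G`, separated in both colours (`ω` and
`flipOn G ω`), of `σ_pq · σ_rs` with `σ_ab = 1[a ~_ω b] − 1[a ~_{flipOn G ω} b]`. -/
lemma pinnedCount_signKer_connState (G : Finset E) (b : Config E) :
    pinnedCount G b (signKer (connState ends p q r s) : Config E → Config E → R) =
      ∑ ω : Config E,
        if (∀ e, e ∉ G → ω e = b e) ∧
            (¬ Conn ends ω p r ∧ ¬ Conn ends ω p s ∧ ¬ Conn ends ω q r ∧ ¬ Conn ends ω q s) ∧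
            (¬ Conn ends (flipOn G ω) p r ∧ ¬ Conn ends (flipOn G ω) p s ∧
              ¬ Conn ends (flipOn G ω) q r ∧ ¬ Conn ends (flipOn G ω) q s)
          then ((if Conn ends ω p q then (1 : R) else 0) -
                (if Conn ends (flipOn G ω) p q then (1 : R) else 0)) *
              ((if Conn ends ω r s then (1 : R) else 0) -
                (if Conn ends (flipOn G ω) r s then (1 : R) else 0))
          else 0 := by
  unfold pinnedCount
  refine Finset.sum_congr rfl fun ω _ => ?_
  rw [signKer_connState]
  by_cases hb : ∀ e, e ∉ G → ω e = b e
  · rw [if_pos hb]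
    by_cases hsep : (¬ Conn ends ω p r ∧ ¬ Conn ends ω p s ∧ ¬ Conn ends ω q r ∧ ¬ Conn ends ω q s) ∧
        (¬ Conn ends (flipOn G ω) p r ∧ ¬ Conn ends (flipOn G ω) p s ∧
          ¬ Conn ends (flipOn G ω) q r ∧ ¬ Conn ends (flipOn G ω) q s)
    · have hall : (∀ e, e ∉ G → ω e = b e) ∧
          (¬ Conn ends ω p r ∧ ¬ Conn ends ω p s ∧ ¬ Conn ends ω q r ∧ ¬ Conn ends ω q s) ∧
          (¬ Conn ends (flipOn G ω) p r ∧ ¬ Conn ends (flipOn G ω) p s ∧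
            ¬ Conn ends (flipOn G ω) q r ∧ ¬ Conn ends (flipOn G ω) q s) := ⟨hb, hsep⟩
      rw [if_pos hsep, if_pos hall, one_mul]
    · have hall : ¬ ((∀ e, e ∉ G → ω e = b e) ∧
          (¬ Conn ends ω p r ∧ ¬ Conn ends ω p s ∧ ¬ Conn ends ω q r ∧ ¬ Conn ends ω q s) ∧
          (¬ Conn ends (flipOn G ω) p r ∧ ¬ Conn ends (flipOn G ω) p s ∧
            ¬ Conn ends (flipOn G ω) q r ∧ ¬ Conn ends (flipOn G ω) q s)) := fun h => hsep h.2
      rw [if_neg hsep, if_neg hall, zero_mul]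
  · have hall : ¬ ((∀ e, e ∉ G → ω e = b e) ∧
        (¬ Conn ends ω p r ∧ ¬ Conn ends ω p s ∧ ¬ Conn ends ω q r ∧ ¬ Conn ends ω q s) ∧
        (¬ Conn ends (flipOn G ω) p r ∧ ¬ Conn ends (flipOn G ω) p s ∧
          ¬ Conn ends (flipOn G ω) q r ∧ ¬ Conn ends (flipOn G ω) q s)) := fun h => hb h.1
    rw [if_neg hb, if_neg hall]

/-- **The typed bridge for the connectivity state map.**  For types in `{1, 2}` on `F`, the typed
m9 sign count of `σ_G` is the sum over the spectator copies `x = z off F` of `g (σ_G x)` times the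
weight-free m9 sign sum of the spectator's fibre `(specFree F τ x, specPin F z τ x)`, written in
connection vocabulary. -/
theorem typedCount_kerSign_connState_eq (F : Finset E) (z : Config E) (τ : E → ℕ)
    (hτ : ∀ e ∈ F, τ e = 1 ∨ τ e = 2) (g : St6 → R) :
    typedCount F z τ (kerSign (connState ends p q r s) g) =
      ∑ x : Config E, if (∀ e, e ∉ F → x e = z e)
        then g (connState ends p q r s x) *
          ∑ ω : Config E,
            if (∀ e, e ∉ specFree F τ x → ω e = specPin F z τ x e) ∧
                (¬ Conn ends ω p r ∧ ¬ Conn ends ω p s ∧ ¬ Conn ends ω q r ∧ ¬ Conn ends ω q s) ∧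
                (¬ Conn ends (flipOn (specFree F τ x) ω) p r ∧
                  ¬ Conn ends (flipOn (specFree F τ x) ω) p s ∧
                  ¬ Conn ends (flipOn (specFree F τ x) ω) q r ∧
                  ¬ Conn ends (flipOn (specFree F τ x) ω) q s)
              then ((if Conn ends ω p q then (1 : R) else 0) -
                    (if Conn ends (flipOn (specFree F τ x) ω) p q then (1 : R) else 0)) *
                  ((if Conn ends ω r s then (1 : R) else 0) -
                    (if Conn ends (flipOn (specFree F τ x) ω) r s then (1 : R) else 0))
              else 0
        else 0 := by
  rw [typedCount_kerSign_eq_sum_spec F z τ hτ (connState ends p q r s) g]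
  refine Finset.sum_congr rfl fun x _ => ?_
  by_cases hx : ∀ e, e ∉ F → x e = z e
  · rw [if_pos hx, if_pos hx, pinnedCount_signKer_connState]
  · rw [if_neg hx, if_neg hx]

end ConnState

end PairHarris

end CovForm

end Summit.Ventures.PercRepro2
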